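import Summits.Ventures.CertifiedArithmetic.Expansions.CompressTopStableStep
import Summits.Ventures.CertifiedArithmetic.Expansions.CompressTerminates

/-!
# COMPRESS twice keeps the top component (new work, part 3 of 3)

New work of the certified-arithmetic venture (ENGINES group: shared numerical engines serving
client cells; rigour lives in the verifiers; every published number belongs to a client cell's
ledger, not to the engines group), concluding the series opened by
`Expansions/CompressTopStableTools.lean` (part 1: read-out lemmas) and
`Expansions/CompressTopStableStep.lean` (part 2: the invariant `J` survives each step).

THE THEOREM (`compress_compress_getLast`).  For `p ≥ 2`, ANY round-to-nearest `fl` (any tie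
rule, gradual underflow) and every nonoverlapping expansion `e` of floats, the largest component
of `COMPRESS(COMPRESS(e))` equals the largest component of `COMPRESS(e)`; hence
(`compress_iterate_getLast`) every iterate of COMPRESS has the same top component as the first.
COMPRESS is NOT idempotent (a second pass may shorten the output at every precision,
`Expansions/CompressNotIdempotentAll.lean`; the number of passes before the iterates freeze is
unbounded, `Expansions/CompressPassesUnbounded.lean`; on tie-free inputs one pass
suffices, `Expansions/CompressTieFreeIdempotent.lean`), and the top component is not a
function of the sum alone (`p = 3`, ties-to-even: `⟨1, 8, 64⟩ ↦ top 64`, `⟨−7, 80⟩ ↦ top 80`,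
both of sum 73).  What IS stable is the top: the
first pass produces the approximation `|Σ e − top| < ulp(top)` of Theorem 23 and no later pass
moves it — all the residual activity of repeated COMPRESS happens strictly below the top.

PROOF.  Induction along the second (upward) traversal of the FIRST pass
(`compressUp_top_stable`), threading Shewchuk's invariant `UpInv`, the error invariant
`|Σ rs| ≤ ulp(Q)/2 · (1 + ε + ⋯)` of `compress_top_error`, the sharp stair of
`CompressSharpStair`, "the carry absorbs the newest component" of `compress_top_absorbed`, and
  `J(rs, Q)`:  the carry `Q` absorbs the top component of `COMPRESS(rs.reverse)`
(part 2 proves that `J` survives the exact and the emitting step).  At the end the output is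
`rs'.reverse ++ [Q_f]` with `J(rs', Q_f)` and `fl(Q_f + r') = Q_f` for the newest `r'`, and the
read-out lemma `getLast?_compress_state` of part 1 (locality of COMPRESS in its top component
plus the fixed pair `⟨r', Q_f⟩`) says precisely that the second pass returns top `Q_f`.

HONEST FRAMING: new work of this programme checked in Lean — a modest qualitative property of a
textbook procedure, not a published result and no open problem; [Shewchuk1997, §2.7 Thm 23
p. 331–333] and [BoldoEtAl2023, §2] supply only the objects.
-/

namespace Summit.Ventures.CertifiedArithmetic.Expansions

open Literature.ComputerArithmetic.JeannerodRump2018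
open Literature.ComputerArithmetic.BoldoJeannerodMelquiondMuller2023 hiding twoSum twoSum_fst
open Literature.ComputerArithmetic.Shewchuk1997

variable {p : ℕ} {emin : ℤ} {fl : ℚ → ℚ}

/-! ### The second traversal with the invariant `J` -/

/-- THE SECOND TRAVERSAL of the first pass, threading `UpInv`, the error invariant, the (sharp)
stair and chain of the remaining components `gs`, "the carry absorbs the newest emitted
component", and `J`: the carry absorbs the top of COMPRESS of the emitted components.
Conclusion: the output is `rs'.reverse ++ [Q_f]` with the same two properties. -/
private theorem compressUp_top_stable (hp : 2 ≤ p) (hfl : IsRoundNearest p emin fl) :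
    ∀ (gs : List ℚ) (Q : ℚ) (rs : List ℚ), UpInv p emin 1 rs Q →
      |rs.sum| ≤ ulp p emin Q / 2 * (Finset.range rs.length).sum (fun i => ((2 : ℚ) ^ p)⁻¹ ^ i) →
      (∀ g ∈ gs, IsFloat p emin g) → (∀ g ∈ gs, (2 : ℚ) ^ (emin + p) ≤ |g|) →
      UStair p emin (Q + rs.sum) gs →
      (∀ (pre post : List ℚ) (g : ℚ), gs = pre ++ g :: post →
        (∃ j : ℤ, emin + p ≤ j ∧ |g| = 2 ^ j) → g * (Q + rs.sum + pre.sum) < 0 →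
        |Q + rs.sum + pre.sum| < ulp p emin g / 2) →
      gs.IsChain (fun a b => |a| ≤ ulp p emin b) →
      (∀ g ∈ gs.head?, |Q| ≤ ulp p emin g) →
      (∀ r ∈ rs.head?, fl (Q + r) = Q) →
      (∀ T, (compress fl rs.reverse).getLast? = some T → fl (Q + T) = Q) →
      ∃ (rs' : List ℚ) (Qf : ℚ), rs.reverse ++ compressUp fl Q gs = rs'.reverse ++ [Qf] ∧
        (∀ r ∈ rs'.head?, fl r = r ∧ r ≠ 0 ∧ fl (Qf + r) = Qf) ∧
        ∀ T, (compress fl rs'.reverse).getLast? = some T → fl (Qf + T) = Qf := by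
  have hp1 : 1 ≤ p := le_trans (by norm_num) hp
  have hflc : RoundoffBelow 1 fl := roundoffBelow_one hp1 hfl
  have h2 : (2 : ℚ) ≠ 0 := by norm_num
  intro gs
  induction gs with
  | nil =>
    intro Q rs inv _ _ _ _ _ _ _ htop hJ
    rw [compressUp_nil]
    exact ⟨rs, Q, rfl, fun r hr =>
      ⟨fl_eq_self hfl (inv.floats r (List.mem_of_mem_head? hr)),
        inv.ne r (List.mem_of_mem_head? hr), htop r hr⟩, hJ⟩
  | cons g rest ih =>
    intro Q rs inv hI hF hbig hst hsh hch hQg htop hJ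
    have hg : IsFloat p emin g := hF g (by simp)
    have hgbig : (2 : ℚ) ^ (emin + p) ≤ |g| := hbig g (by simp)
    have hQg' : |Q| ≤ ulp p emin g := hQg g (by simp)
    have hF' : ∀ x ∈ rest, IsFloat p emin x := fun x hx => hF x (List.mem_cons_of_mem _ hx)
    have hbig' : ∀ x ∈ rest, (2 : ℚ) ^ (emin + p) ≤ |x| :=
      fun x hx => hbig x (List.mem_cons_of_mem _ hx)
    obtain ⟨hstg, hst'⟩ := uStair_cons.mp hst
    obtain ⟨hgU, hch'⟩ := List.isChain_cons.mp hch
    have hg0 : g ≠ 0 := by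
      intro h; rw [h, abs_zero] at hgbig
      exact absurd hgbig (not_le.mpr (zpow_pos (by norm_num) _))
    have hulpg : ulp p emin g ≤ |g| := ulp_le_abs_of_isFloat hg hg0
    have hQleg : |Q| ≤ |g| := hQg'.trans hulpg
    obtain ⟨h1, -, h2', h4⟩ := fastTwoSum_exact hp1 hfl hg inv.hQ hQleg
    -- the sharp stair under `g` itself
    have hsh_g : (∃ j : ℤ, emin + p ≤ j ∧ |g| = 2 ^ j) → g * (Q + rs.sum) < 0 →
        |Q + rs.sum| < ulp p emin g / 2 := by
      intro hpow hsgn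
      have := hsh [] rest g rfl hpow (by simpa using hsgn)
      simpa using this
    -- … and under the later components, re-addressed for the next state `(Qn, rs')`
    have hthread : ∀ (Qn : ℚ) (rs' : List ℚ), Qn + rs'.sum = Q + rs.sum + g →
        ∀ (pre post : List ℚ) (g' : ℚ), rest = pre ++ g' :: post →
          (∃ j : ℤ, emin + p ≤ j ∧ |g'| = 2 ^ j) → g' * (Qn + rs'.sum + pre.sum) < 0 →
          |Qn + rs'.sum + pre.sum| < ulp p emin g' / 2 := by
      intro Qn rs' hS pre post g' hsplit hpow hsgn
      have heq : Q + rs.sum + (g :: pre).sum = Qn + rs'.sum + pre.sum := by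
        rw [List.sum_cons, hS]; ring
      have := hsh (g :: pre) post g' (by rw [hsplit]; rfl) hpow (by rw [heq]; exact hsgn)
      rwa [heq] at this
    by_cases hq : (fastTwoSum fl g Q).2 = 0
    · -- EXACT STEP: the carry becomes `g + Q`, nothing is emitted
      obtain ⟨inv', hQnval, hQn_ge⟩ := inv.absorb hp hfl hg hgbig hQg' hq
      rw [compressUp_cons_of_eq_zero hq]
      generalize hQn : (fastTwoSum fl g Q).1 = Qn at *
      have hS : Qn + rs.sum = Q + rs.sum + g := by rw [hQnval]; ring
      have hQg_next : ∀ y ∈ rest.head?, |Qn| ≤ ulp p emin y := by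
        intro y hy
        have hgy : |g| ≤ ulp p emin y := hgU y hy
        have hT : |Qn + rs.sum| < ulp p emin y := by rw [hS]; exact hst'.head_lt hy
        obtain ⟨u, -, hU⟩ := exists_ulp_eq_two_zpow (p := p) (emin := emin) y
        obtain ⟨k, -, hK⟩ := exists_ulp_eq_two_zpow (p := p) (emin := emin) Q
        have hkQ : OnGrid k Q := by
          obtain ⟨K, hK'⟩ := exists_eq_int_mul_ulp_of_isFloat (p := p) (emin := emin) inv.hQ
          exact ⟨K, by rw [← hK]; exact hK'⟩
        have hkg : OnGrid k g := onGrid_of_two_zpow_le_ulp hg (by rw [← hK]; exact ulp_mono hQleg)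
        have hkQn : OnGrid k Qn := by rw [hQnval]; exact hkg.add hkQ
        have hku : k ≤ u := by
          have : (2 : ℚ) ^ k ≤ (2 : ℚ) ^ u := by
            rw [← hK, ← hU]; exact (ulp_mono hQleg).trans (hulpg.trans hgy)
          exact (zpow_le_zpow_iff_right₀ (by norm_num : (1 : ℚ) < 2)).mp this
        have hr : |rs.sum| < (2 : ℚ) ^ k := by rw [← hK]; exact inv.sum_lt
        rw [hU]
        exact abs_le_two_zpow_of_onGrid hku hkQn hr (by rw [← hU]; exact hT)
      have hI' : |rs.sum| ≤ ulp p emin Qn / 2 *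
          (Finset.range rs.length).sum (fun i => ((2 : ℚ) ^ p)⁻¹ ^ i) :=
        hI.trans (mul_le_mul_of_nonneg_right
          (by linarith [ulp_mono (p := p) (emin := emin) hQn_ge]) (geomFactor_nonneg _))
      have hQnF : IsFloat p emin (g + Q) := hQnval ▸ inv'.hQ
      -- the new carry `g + Q` absorbs the newest component …
      have htop' : ∀ r ∈ rs.head?, fl (Qn + r) = Qn := by
        intro r hr
        have hfr := htop r hr
        have hrm : r ∈ rs := List.mem_of_mem_head? hr
        have hrs : rs = r :: rs.tail := by
          cases rs with
          | nil => simp at hr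
          | cons a t =>
            simp only [List.head?_cons, Option.mem_def, Option.some.injEq] at hr
            simp [hr]
        have htl : |rs.tail.sum| < |r| := by
          rw [hrs] at inv; exact abs_sum_tail_lt_head inv.floats inv.pw inv.ne
        have hsum : rs.sum = r + rs.tail.sum := by nth_rewrite 1 [hrs]; exact List.sum_cons
        rw [hQnval]
        exact fl_add_eq_self_after_absorb hp hfl hgbig inv.hQ hQg' hQnF (inv.floats r hrm)
          (inv.ne r hrm) (abs_le_half_ulp_of_fl_add_eq hp1 hfl hfr) hfr
          (by rw [← hsum]; exact hstg) htl
      -- … and the top of COMPRESS of the emitted components (part 2)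
      have hJ' : ∀ T, (compress fl rs.reverse).getLast? = some T → fl (Qn + T) = Qn := by
        rw [hQnval]; exact fl_add_eq_self_absorb_top hp hfl inv hgbig hQg' hstg hQnF hJ
      exact ih Qn rs inv' hI' hF' hbig' (by rw [hS]; exact hst') (hthread Qn rs hS) hch'
        hQg_next htop' hJ'
    · -- EMITTING STEP: `q ≠ 0` is pushed on top of `rs`, the carry becomes `Qn = fl (g + Q)`
      obtain ⟨inv', hbound⟩ := inv.emit hp hfl le_rfl hflc hg hgbig hQg' hq
      rw [compressUp_cons_of_ne_zero hq]
      generalize hQn : (fastTwoSum fl g Q).1 = Qn at *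
      generalize hqn : (fastTwoSum fl g Q).2 = q at *
      have hS : Qn + (q :: rs).sum = Q + rs.sum + g := by rw [List.sum_cons]; linarith [h4]
      have hQg_next : ∀ y ∈ rest.head?, |Qn| ≤ ulp p emin y := by
        intro y hy
        have hgy : |g| ≤ ulp p emin y := hgU y hy
        have hT : |Qn + (q :: rs).sum| < ulp p emin y := by rw [hS]; exact hst'.head_lt hy
        obtain ⟨u, hu, hU⟩ := exists_ulp_eq_two_zpow (p := p) (emin := emin) y
        obtain ⟨k, -, hK⟩ := exists_ulp_eq_two_zpow (p := p) (emin := emin) (g + Q)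
        have hkQn : OnGrid k Qn := by
          obtain ⟨K, hK'⟩ := exists_fl_eq_int_mul_ulp hp1 hfl (g + Q)
          exact ⟨K, by rw [h1, hK', hK]⟩
        have hku : k ≤ u := by
          have ht2 : |g + Q| ≤ 2 * (2 : ℚ) ^ u :=
            calc |g + Q| ≤ |g| + |Q| := abs_add_le _ _
              _ ≤ |g| + |g| := by linarith
              _ ≤ 2 * (2 : ℚ) ^ u := by rw [← hU]; linarith
          have := ulp_le_two_zpow_of_abs_le hp hu ht2
          rw [hK] at this
          exact (zpow_le_zpow_iff_right₀ (by norm_num : (1 : ℚ) < 2)).mp this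
        have hr : |(q :: rs).sum| < (2 : ℚ) ^ k := by rw [← hK, List.sum_cons]; exact hbound
        rw [hU]
        exact abs_le_two_zpow_of_onGrid hku hkQn hr (by rw [← hU]; exact hT)
      -- the error invariant (as in `compress_top_error`): the old carry lies below the ulp of
      -- the new one, so what was emitted before shrinks by `ε = 2^-p` relative to it
      have hcarry : |Q| < ulp p emin Qn := by
        rw [h1]
        exact compressUp_carry_lt_ulp hp hfl inv hg hgbig hQg' (by rw [← h2']; exact hq) hsh_g
      have hrs : |rs.sum| ≤ ((2 : ℚ) ^ p)⁻¹ * ulp p emin Qn / 2 *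
          (Finset.range rs.length).sum (fun i => ((2 : ℚ) ^ p)⁻¹ ^ i) := by
        cases rs with
        | nil => simp
        | cons r tail =>
          obtain ⟨u, hu, hU⟩ := exists_ulp_eq_two_zpow (p := p) (emin := emin) Qn
          obtain ⟨hup, hulpQ⟩ := ulp_le_two_zpow_of_upInv_cons inv (by rw [← hU]; exact hcarry)
          have hfac : (2 : ℚ) ^ (u - (p : ℤ)) = ((2 : ℚ) ^ p)⁻¹ * ulp p emin Qn := by
            rw [hU, zpow_sub₀ (by norm_num : (2 : ℚ) ≠ 0), zpow_natCast, div_eq_inv_mul]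
          rw [hfac] at hulpQ
          exact hI.trans (mul_le_mul_of_nonneg_right (by linarith) (geomFactor_nonneg _))
      have hq_half : |q| ≤ ulp p emin Qn / 2 := by
        rw [h2', h1]; exact abs_sub_fl_le_half_ulp_fl hp1 hfl (g + Q)
      have hI' : |(q :: rs).sum| ≤ ulp p emin Qn / 2 *
          (Finset.range (q :: rs).length).sum (fun i => ((2 : ℚ) ^ p)⁻¹ ^ i) := by
        rw [List.length_cons, geomFactor_succ, List.sum_cons]
        calc |q + rs.sum| ≤ |q| + |rs.sum| := abs_add_le _ _
          _ ≤ ulp p emin Qn / 2 + ((2 : ℚ) ^ p)⁻¹ * ulp p emin Qn / 2 *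
              (Finset.range rs.length).sum (fun i => ((2 : ℚ) ^ p)⁻¹ ^ i) :=
            add_le_add hq_half hrs
          _ = _ := by ring
      have hq0 : q ≠ 0 := hq
      have h4' : Qn + q = g + Q := h4
      -- the new carry absorbs the newest component `q` (the FAST-TWO-SUM is exact) …
      have htop' : ∀ r ∈ (q :: rs).head?, fl (Qn + r) = Qn := by
        intro r hr
        have hrq : r = q := by simpa [eq_comm] using hr
        rw [hrq, h4']; exact h1.symm
      -- … and the top of COMPRESS of the emitted components (part 2: the emit dichotomy)
      have hJ' : ∀ T', (compress fl (q :: rs).reverse).getLast? = some T' →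
          fl (Qn + T') = Qn :=
        fl_add_eq_self_emit_top hp hfl inv hI hg hgbig hQg' hsh_g h1.symm h4' hq0 inv' htop hJ
      have hlist : rs.reverse ++ q :: compressUp fl Qn rest =
          (q :: rs).reverse ++ compressUp fl Qn rest := by simp
      rw [hlist]
      exact ih Qn (q :: rs) inv' hI' hF' hbig' (by rw [hS]; exact hst') (hthread Qn (q :: rs) hS)
        hch' hQg_next htop' hJ'

/-! ### The theorems -/

/-- **COMPRESS TWICE KEEPS THE TOP COMPONENT** (`p ≥ 2`, ANY round-to-nearest — any tie rule —
with gradual underflow): for every nonoverlapping expansion `e` of floats, the largest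
component of `COMPRESS(COMPRESS(e))` is the largest component of `COMPRESS(e)`.
[cite: Shewchuk1997, §2.7 Thm 23 p. 331–333 (algorithm; the property itself is new work)]
[cite: BoldoEtAl2023, §2.6 Properties 2.7–2.9 (rounding facts used)] -/
theorem compress_compress_getLast (hp : 2 ≤ p) (hfl : IsRoundNearest p emin fl) {e : List ℚ}
    (he : ∀ x ∈ e, IsFloat p emin x) (hexp : IsExpansion 1 e) :
    (compress fl (compress fl e)).getLast? = (compress fl e).getLast? := by
  have h0 : fl 0 = 0 := fl_zero hfl
  cases hrev : e.reverse with
  | nil =>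
    have he0 : e = [] := by simpa using congrArg List.reverse hrev
    subst he0; simp [compress]
  | cons em rest =>
    have he' : e = rest.reverse ++ [em] := by simpa using congrArg List.reverse hrev
    have hcomp : compress fl e =
        compressUp fl (compressDown fl em rest).2 (compressDown fl em rest).1.reverse := by
      simp only [compress, hrev]
    rw [hcomp]
    subst he'
    have hem : IsFloat p emin em := he em (by simp)
    have hrestF : ∀ y ∈ rest, IsFloat p emin y := fun y hy => he y (by simp [hy])
    have hexp' : IsExpansion 1 rest.reverse := hexp.sublist (List.sublist_append_left _ _)
    have hbel : ∀ y ∈ rest, Below 1 y em := fun y hy =>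
      (List.pairwise_append.mp hexp).2.2 y (List.mem_reverse.mpr hy) em (by simp)
    have outd := compressDown_spec hp hfl rest em hem hrestF hexp' hbel
    have hsharpD := compressDown_sharp_stair hp hfl rest em hem hrestF hexp' hbel
    generalize (compressDown fl em rest).1 = gs at *
    generalize (compressDown fl em rest).2 = gb at *
    have inv : UpInv p emin 1 [] gb :=
      ⟨by simp, outd.hgb, List.Pairwise.nil, by simp, by simp, by simpa using ulp_pos _⟩
    have hst : UStair p emin (gb + ([] : List ℚ).sum) gs.reverse := by
      have h := uStair_reverse_of_dStair outd.stair
      rw [List.reverse_append, List.reverse_singleton, List.singleton_append, uStair_cons,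
        zero_add] at h
      simpa using h.2
    have hch0 := List.isChain_reverse.mpr outd.chain
    rw [List.reverse_append, List.reverse_singleton, List.singleton_append,
      List.isChain_cons] at hch0
    -- the sharp stair, re-addressed from the bottom as the second traversal sees it
    have hsharpU : ∀ (pre post : List ℚ) (g : ℚ), gs.reverse = pre ++ g :: post →
        (∃ j : ℤ, emin + p ≤ j ∧ |g| = 2 ^ j) → g * (gb + ([] : List ℚ).sum + pre.sum) < 0 →
        |gb + ([] : List ℚ).sum + pre.sum| < ulp p emin g / 2 := by
      intro pre post g hsplit hpow hsgn
      have hgs : gs = post.reverse ++ g :: pre.reverse := by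
        simpa using congrArg List.reverse hsplit
      have hsum : (pre.reverse ++ [gb]).sum = gb + ([] : List ℚ).sum + pre.sum := by
        simp [List.sum_reverse, add_comm]
      have h := hsharpD post.reverse (pre.reverse ++ [gb]) g (by rw [hgs]; simp) hpow
        (by rw [hsum]; exact hsgn)
      rwa [hsum] at h
    obtain ⟨rs', Qf, hout, hb, hJ⟩ := compressUp_top_stable hp hfl gs.reverse gb [] inv
      (by simp) (fun g hg => outd.floats g (List.mem_reverse.mp hg))
      (fun g hg => outd.big g (List.mem_reverse.mp hg)) hst hsharpU hch0.2 hch0.1 (by simp)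
      (by simp [compress])
    rw [List.reverse_nil, List.nil_append] at hout
    rw [hout, getLast?_compress_state h0 hb hJ]
    simp

/-- Hence EVERY ITERATE of COMPRESS has the top component of the first.
[cite: Shewchuk1997, §2.7 Thm 23 p. 331–333] -/
theorem compress_iterate_getLast (hp : 2 ≤ p) (hfl : IsRoundNearest p emin fl) {e : List ℚ}
    (he : ∀ x ∈ e, IsFloat p emin x) (hexp : IsExpansion 1 e) (n : ℕ) :
    ((compress fl)^[n + 1] e).getLast? = (compress fl e).getLast? := by
  induction n with
  | zero => simp
  | succ n ih =>
    obtain ⟨hF, hE⟩ := compress_iterate_floats_isExpansion hp hfl he hexp n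
    rw [Function.iterate_succ_apply', Function.iterate_succ_apply',
      compress_compress_getLast hp hfl hF hE, ← Function.iterate_succ_apply' (compress fl) n e]
    exact ih

end Summit.Ventures.CertifiedArithmetic.Expansions
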